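import Summits.QuantumFields.YangMills.Theorems.BalabanUVNodesN27LedgerJoinTail

/-!
# BalabanUVNodes ∕ N27 — THE BUDGET CONJUNCT OF THE CHILDREN'S PACKAGE IS REDUNDANT: binder B5 (`T4ApexHybrid.HybridNE7Under D Hβ`) is
# EQUIVALENT to the road-agnostic K5 package «N20 ∧ N21 ∧ N19 (`Core`) ∧ `Summable δ` ∧ E1∕E2 at some carriers per string under the
# prefix» WITHOUT the clause `∀ K, W K + Wsh K < 1`
# (cell `pub-ymgap`, HUMAN RULING D-0062 Track A, seat `pub-ymgap-dag-n27-a` g3; `--supports stmt-QuantumFields-19182`, count-neutral)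

WHY.  g0's glue `BalabanUVNodesSpineGivenEndpointN27.hybridNE7Under_of_spineNodes` ∕ `hybridNE7Under_iff_spineNodes` (p409417) states the
composite node as EQUIVALENT to the per-string ∃-package `0 < l₀ ∧ 0 < vol ∧ RelWeightBound ∧ ShellWeightBound ∧ Spine.NE7.Core ∧
(∀ K, W K + Wsh K < 1) ∧ Summable δ ∧ E1 ∧ E2` under the targets' prefix — VERBATIM the dagwriter's `YMDAG.UVSplit.SpineDatum D g₀ os`
(module 1 v2, approved-unfiled).  File IX of this seat (`…N27LedgerJoinTail`, §1 `stringHybridNE7_of_spineNodes_tail`) discharges the budget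
clause in the tail from the two weight structures' OWN summability fields (the tree's typing decision (Z3)).  THIS module records the
consequence at the K5 level, ROAD-AGNOSTIC (any producer of `Spine.NE7.Core` — term-wise road, count road's witness unpacked, tower
variants): B5 ⇔ the package WITHOUT the budget conjunct.  Hence a record predicate ∕ `SpineDatum` need not carry a «budget < 1» clause
(K5 typing input for the rev-1 texts); nothing else of g0's faithfulness statement changes.

WHAT IS KERNEL-CHECKED ([bookkeeping] ∕ [folklore]; 0 `def`, 0 `sorry`; g0's module is NOT imported — restate-immune).
* `hybridNE7Under_of_spineNodes_tail` — the package without the budget clause ⇒ `HybridNE7Under D Hβ` (IX §1 per string; B5's `∃ K₀`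
  absorbs the origin shift).
* `hybridNE7Under_iff_spineNodes_tail` — FAITHFULNESS without the budget clause: `HybridNE7Under D Hβ ↔` that package (forward: unfold
  `StringwiseHybridNE7` ∕ `StringHybridNE7` ∕ `HybridNE7`'s fields and drop `lt_one`).

HONEST FRAMING.  COMPOSITE-node bookkeeping: NE7∕NE7b∕NE7c are HYPOTHESIS SHAPES (none printed for Bałaban's d = 4 procedure, none proved);
nothing of Bałaban's objects is instantiated; NO node is discharged; (B) and `Hβ` are antecedents, used, never refuted; one fixed finite
four-torus — NOT ℝ⁴, NOT infinite volume, NOT OS axioms, NOT a mass gap, NOT Clay.  Typed 28∕28; the discharged count is not touched by this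
file.  No decl below carries a cite tag.
-/

open Finset MeasureTheory

namespace Summit.QuantumFields.YangMills.Theorems.BalabanUVNodesN27SpineRecord

open Literature.MathematicalPhysics.QuantumFieldTheory.Balaban1983to89
open Literature.MathematicalPhysics.QuantumFieldTheory.Balaban1983to89.T4Continuum
open T4WeightBudget (RelWeightBound)
open T4IndicatorShell (ShellWeightBound)
open T4MatchingAssembly (HybridNE7 StringHybridNE7)
open Summit.QuantumFields.BalabanUV.T4Continuum.Spine

section Datum

variable {F : T4Family} {G : Type*} [GaugeGroup G] [MeasurableSpace G] [HaarData G]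

/-- **N27 = B5 AT THE DATUM, CHILDREN AS HYPOTHESES, NO BUDGET CLAUSE** (g0's `hybridNE7Under_of_spineNodes` MINUS `∀ K, W K + Wsh K < 1`).
If, under the targets' prefix, every loop string `os` carries term-class carriers with `0 < l₀`, `0 < vol` at which N20 (`RelWeightBound`),
N21 (`ShellWeightBound`), N19 (`Spine.NE7.Core` on the shell-free cores with a summable `δ`) and the E1∕E2 dictionary against
`T4GenFunBounds.schemeZ (D.scheme g₀) os (K₀ + K)` hold, then `T4ApexHybrid.HybridNE7Under D Hβ` — the budget clause holds from some origin
`K₀ + K₁` on by the weight structures' own `summable` fields and everything is re-based there (`stringHybridNE7_of_spineNodes_tail`), the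
offset being existential in B5's currency.  ROAD-AGNOSTIC in the producer of `Core`. [bookkeeping] [folklore] -/
theorem hybridNE7Under_of_spineNodes_tail (D : FiniteEpsData F G) {Hβ : Prop}
    (h : D.UnderHypotheses Hβ fun g₀ => ∀ os : List (ULoop F),
      ∃ (ι : Type) (_ : DecidableEq ι) (l₀ vol : ℝ) (K₀ : ℕ) (T : ℕ → Finset ι) (A B shA shB : ℕ → ℝ → ι → ℝ)
        (Bad : ℕ → ℝ → Finset ι) (W Wsh δ : ℕ → ℝ),
        0 < l₀ ∧ 0 < vol ∧
          RelWeightBound l₀ T A B Bad W ∧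
          ShellWeightBound l₀ T A B shA shB Wsh ∧
          NE7.Core l₀ vol T Bad (fun K t τ => A K t τ - shA K t τ) (fun K t τ => B K t τ - shB K t τ) δ ∧
          Summable δ ∧
          (∀ K t, |t| ≤ l₀ → T4GenFunBounds.schemeZ (D.scheme g₀) os (K₀ + K) t = ∑ τ ∈ T K, A K t τ) ∧
          (∀ K t, |t| ≤ l₀ → T4GenFunBounds.schemeZ (D.scheme g₀) os (K₀ + K + 1) t = ∑ τ ∈ T K, B K t τ)) :
    T4ApexHybrid.HybridNE7Under D Hβ :=
  FiniteEpsData.UnderHypotheses.mono (fun g₀ hg os => by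
    obtain ⟨ι, _, l₀, vol, K₀, T, A, B, shA, shB, Bad, W, Wsh, δ, hl₀, hvol, h20, h21, h19, hδ, hE1, hE2⟩ := hg os
    obtain ⟨K₁, hS⟩ := stringHybridNE7_of_spineNodes_tail (D.scheme g₀) os K₀ h20 h21 ⟨δ, h19, hδ⟩ hE1 hE2
    exact ⟨l₀, vol, K₀ + K₁, hl₀, hvol, hS⟩) h

/-- **FAITHFULNESS WITHOUT THE BUDGET CLAUSE: THE NODE IS THE CHILDREN'S PACKAGE, BUDGET CONJUNCT DROPPED.**
`T4ApexHybrid.HybridNE7Under D Hβ` is EQUIVALENT to the hypothesis of `hybridNE7Under_of_spineNodes_tail` — the composite binder B5 says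
nothing beyond N19 ∧ N20 ∧ N21 ∧ `Summable δ` ∧ E1∕E2 at some carriers per string under the prefix; compared with g0's
`hybridNE7Under_iff_spineNodes` the conjunct `∀ K, W K + Wsh K < 1` is REDUNDANT (forward direction: unfold `StringwiseHybridNE7` ∕
`StringHybridNE7` ∕ the fields of `HybridNE7` and drop `lt_one`).  K5 typing consequence: a record predicate ∕ `SpineDatum` needs no
«budget < 1» clause. [bookkeeping] [folklore] -/
theorem hybridNE7Under_iff_spineNodes_tail (D : FiniteEpsData F G) (Hβ : Prop) :
    T4ApexHybrid.HybridNE7Under D Hβ ↔ D.UnderHypotheses Hβ fun g₀ => ∀ os : List (ULoop F),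
      ∃ (ι : Type) (_ : DecidableEq ι) (l₀ vol : ℝ) (K₀ : ℕ) (T : ℕ → Finset ι) (A B shA shB : ℕ → ℝ → ι → ℝ)
        (Bad : ℕ → ℝ → Finset ι) (W Wsh δ : ℕ → ℝ),
        0 < l₀ ∧ 0 < vol ∧
          RelWeightBound l₀ T A B Bad W ∧
          ShellWeightBound l₀ T A B shA shB Wsh ∧
          NE7.Core l₀ vol T Bad (fun K t τ => A K t τ - shA K t τ) (fun K t τ => B K t τ - shB K t τ) δ ∧
          Summable δ ∧
          (∀ K t, |t| ≤ l₀ → T4GenFunBounds.schemeZ (D.scheme g₀) os (K₀ + K) t = ∑ τ ∈ T K, A K t τ) ∧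
          (∀ K t, |t| ≤ l₀ → T4GenFunBounds.schemeZ (D.scheme g₀) os (K₀ + K + 1) t = ∑ τ ∈ T K, B K t τ) := by
  refine ⟨fun h => FiniteEpsData.UnderHypotheses.mono (fun g₀ hg os => ?_) h, hybridNE7Under_of_spineNodes_tail D⟩
  obtain ⟨l₀, vol, K₀, hl₀, hvol, hS⟩ := hg os
  obtain ⟨ι, _, T, A, B, shA, shB, Bad, W, Wsh, δ, hH, hE1, hE2⟩ := hS
  exact ⟨ι, ‹_›, l₀, vol, K₀, T, A, B, shA, shB, Bad, W, Wsh, δ, hl₀, hvol, hH.weight, hH.shell, NE7.core_of_hybridNE7 hH,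
    hH.summable, hE1, hE2⟩

end Datum

end Summit.QuantumFields.YangMills.Theorems.BalabanUVNodesN27SpineRecord
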